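import Mathlib
import Summits.Ventures.DiscreteObjects.Mahler.SubLehmerDegree56

/-!
# Cyclotomic-freeness is `x ↦ -x` invariant (venture `DiscreteObjects`, target L)

Cell `pub-namedobj`, seat `pub-namedobj-mahler` (gen 7). Framing: lottery ticket; floor = certified
bounds/negative ranges.

The census runs quotient by the symmetry `P ↦ P(-x)` ("xsym", `METHOD-L6c.md`); lifting a run's
statement back to ALL polynomials needs every census predicate to be `x ↦ -x` invariant.  Height,
Mahler measure (`GraeffeIdentity.mahlerMeasure_comp_neg_X`), degree and irreducibility are
(`Height1CellSymmetry`); this file proves it for CYCLOTOMIC-FREENESS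
(`∀ m > 0, ¬ Φ_m ∣ P`), for every index `m` (not only the census's nine): if `Φ_m ∣ P(-x)` then `-ζ_m` is
a root of `P` and a root of unity, so `Φ_{m'} ∣ P` with `m'` the order of `-ζ_m`
(`cyclotomic_dvd_of_cyclotomic_dvd_comp_neg_X`, `cyclotomicFree_comp_neg_X`, `cyclotomicFree_neg`).
Together with `height_comp_neg_X`, `subLehmer_comp_neg_X_iff` (`Height1CellSymmetry`) and
`height_neg`, `intMahlerMeasure_neg`, this makes the cyclotomic-free height-bounded sub-Lehmer slice at
any degree closed under `P ↦ P(-x)` and `P ↦ -P` — what a successor needs to turn an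
"xsym"-quotiented run certificate into the typed statement `CyclotomicFreeHeight1Degree56SubLehmerEmpty`.
-/

namespace Summit.Ventures.DiscreteObjects.Mahler

open Polynomial

/-- If `Φ_m(x) ∣ P(-x)` (`m > 0`) then some `Φ_{m'} ∣ P(x)` (`m' > 0`): `-ζ_m` is a root of `P` and a
root of unity. -/
theorem cyclotomic_dvd_of_cyclotomic_dvd_comp_neg_X {P : ℤ[X]} {m : ℕ} (hm : 0 < m)
    (hdvd : cyclotomic m ℤ ∣ P.comp (-X)) : ∃ m' : ℕ, 0 < m' ∧ cyclotomic m' ℤ ∣ P := by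
  -- a primitive m-th root of unity ζ ∈ ℂ is a root of P(-x), so -ζ is a root of P
  set ζ : ℂ := Complex.exp (2 * Real.pi * Complex.I / m) with hζ
  have hprim : IsPrimitiveRoot ζ m := Complex.isPrimitiveRoot_exp m (by omega)
  have hroot : aeval ζ (cyclotomic m ℤ) = 0 := by
    have h := hprim.isRoot_cyclotomic hm (R := ℂ)
    rw [IsRoot.def, ← map_cyclotomic_int, eval_map] at h
    rwa [aeval_def, algebraMap_int_eq]
  have hPζ : aeval (-ζ) P = 0 := by
    obtain ⟨R, hR⟩ := hdvd
    have h1 : aeval ζ (P.comp (-X)) = 0 := by rw [hR, map_mul, hroot, zero_mul]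
    rwa [aeval_comp, map_neg, aeval_X] at h1
  -- -ζ is a root of unity, of some order m' > 0
  set μ : ℂ := -ζ with hμ
  have hfin : IsOfFinOrder μ := by
    rw [isOfFinOrder_iff_pow_eq_one]
    refine ⟨2 * m, by omega, ?_⟩
    rw [hμ, neg_pow, pow_mul, neg_one_sq, one_pow, one_mul, pow_mul', hprim.pow_eq_one, one_pow]
  have hord : 0 < orderOf μ := hfin.orderOf_pos
  have hprim' : IsPrimitiveRoot μ (orderOf μ) := IsPrimitiveRoot.orderOf μ
  refine ⟨orderOf μ, hord, ?_⟩
  rw [cyclotomic_eq_minpoly hprim' hord]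
  exact minpoly.isIntegrallyClosed_dvd (hprim'.isIntegral hord) hPζ

/-- **Cyclotomic-freeness is `x ↦ -x` invariant.** -/
theorem cyclotomicFree_comp_neg_X {P : ℤ[X]} (hP : ∀ m : ℕ, 0 < m → ¬ cyclotomic m ℤ ∣ P) :
    ∀ m : ℕ, 0 < m → ¬ cyclotomic m ℤ ∣ P.comp (-X) := by
  intro m hm hdvd
  obtain ⟨m', hm', h'⟩ := cyclotomic_dvd_of_cyclotomic_dvd_comp_neg_X hm hdvd
  exact hP m' hm' h'

/-- Cyclotomic-freeness is invariant under `P ↦ -P`. -/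
theorem cyclotomicFree_neg {P : ℤ[X]} (hP : ∀ m : ℕ, 0 < m → ¬ cyclotomic m ℤ ∣ P) :
    ∀ m : ℕ, 0 < m → ¬ cyclotomic m ℤ ∣ -P := by
  intro m hm hdvd
  exact hP m hm (dvd_neg.mp hdvd)

end Summit.Ventures.DiscreteObjects.Mahler
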